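import Summits.ABC.StewartYu.PadicG3TwoThirdValues
import Summits.ABC.StewartYu.PadicMulticubic
import HarnessLib

/-!
# Cell abc-stewartyu, Gen-3 frame at `p = 2` (crux `Y07Two`, stmt-ABC-19659), F5 brick 2: `φ_τ(s/3)` IS THE
# EVALUATION AT THE CUBE ROOTS OF THE TRIADIC CLASS SUMS (signed exponents)

`Summits/ABC/StewartYu/PadicG3TwoThirdClass.lean` — cell `abc-stewartyu` (HOME `run/shared/lean/pub/abc-stewartyu/`),
route `PadicPrimesKummerThird`, seat p3 (g5), F-two LEAD; second brick of the third step F5 (signed twin of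
p3-g3's `SetupQ.sum_prod_cbrt_pow_eq_ev3` / `classVec3` of `DescentThirdQ`).

For a signed exponent vector `κ` and an integer `s`, Euclidean division `κₖ s = 3·qₖ + rₖ` (`0 ≤ rₖ < 3`) splits
the cube-root monomial `∏ₖ cbrt_k^{κₖ s} = (∏ₖ all_k^{qₖ}) · mono3 cbrt r` (`prod_cbrt_zpow_eq`; rational part
`qPart3`, class `res3`).  Grouping the unknowns of `PadicG3TwoThirdValues.g3Φ_third` by class:
`φ_τ(s/3) = Multicub.ev3 cbrt (thirdVec B p τ s)` (`g3Φ_third_eq_ev3`) with the RATIONAL class sums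
`thirdVec … r = ∑_{i : res3 κᵢ s = r} pᵢ·(Hasse_{t₀} Rᵢ)(s/3)·∏ zγⱼ(i)^{tⱼ}·qPart3 κᵢ s` — the vector lit's
multicubic Liouville inequality `MulticubLiouville.norm_ev3_ge_padic_rat` (via
`SetupQ`-free `Multicub.ev3`) bounds from below unless it vanishes (Yu's Lemma 5.3 at `q = 3`).

WHAT THIS IS NOT: no Liouville / denominators / re-indexing yet; no crux moves.

References: K. Yu, Compositio Math. 74 (1990), §3 (2.93)–(2.95); K. Yu, Acta Arith. 53 (1989), §3.
-/

noncomputable section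

open Finset NormedSpace Polynomial
open Literature.NumberTheory.Transcendental
open Literature.NumberTheory.Transcendental.CW77.Setup (Tau tauNorm)

namespace Summit.ABC.StewartYu

namespace TwoSetup

variable (S : TwoSetup)

/-! ### Class and rational part of a signed exponent vector at `s` -/

/-- The triadic CLASS of the signed exponent vector `κ` at `s`: `(κₖ s mod 3)ₖ ∈ {0,1,2}^{d+1}`. [cite: Yu1989, §3] -/
def res3 (κ : Fin (S.d + 1) → ℤ) (s : ℤ) : Fin (S.d + 1) → Fin 3 := fun k =>
  ⟨((κ k * s) % 3).toNat, by
    have h0 : 0 ≤ (κ k * s) % 3 := Int.emod_nonneg _ (by norm_num)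
    have h1 : (κ k * s) % 3 < 3 := Int.emod_lt_of_pos _ (by norm_num)
    omega⟩

/-- The class entry as an integer is the Euclidean residue. [folklore] -/
theorem res3_coe (κ : Fin (S.d + 1) → ℤ) (s : ℤ) (k : Fin (S.d + 1)) :
    (((S.res3 κ s k : Fin 3) : ℕ) : ℤ) = (κ k * s) % 3 := by
  unfold res3
  simp only
  exact Int.toNat_of_nonneg (Int.emod_nonneg _ (by norm_num))

/-- The RATIONAL PART `∏ₖ all_k^{⌊κₖ s/3⌋}` of the cube-root monomial. [cite: Yu1989, §3] -/
def qPart3 (κ : Fin (S.d + 1) → ℤ) (s : ℤ) : ℚ := ∏ k : Fin (S.d + 1), S.toQ.all k ^ ((κ k * s) / 3)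

/-- `qPart3 ≠ 0`. [folklore] -/
theorem qPart3_ne_zero (κ : Fin (S.d + 1) → ℤ) (s : ℤ) : S.qPart3 κ s ≠ 0 :=
  prod_ne_zero_iff.mpr fun k _ => zpow_ne_zero _ (S.toQ.all_ne k)

/-- **`∏ₖ cbrt_k^{κₖ s} = qPart3 · mono3 cbrt (res3)`**. [cite: Yu1989, §3] -/
theorem prod_cbrt_zpow_eq (κ : Fin (S.d + 1) → ℤ) (s : ℤ) :
    ∏ k : Fin (S.d + 1), S.cbrt k ^ (κ k * s) =
      (S.qPart3 κ s : ℚ_[2]) * Multicub.mono3 S.cbrt (S.res3 κ s) := by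
  unfold qPart3 Multicub.mono3
  push_cast
  rw [← prod_mul_distrib]
  refine prod_congr rfl fun k _ => ?_
  rw [S.cbrt_zpow_eq k (κ k * s), ← zpow_natCast, S.res3_coe]

/-! ### The class sums and the identity -/

variable {ι : Type*} (R : ι → ℚ[X]) (u : ι → Fin S.d → ℤ) (uθ : ι → ℤ)

/-- **The triadic class sums of `φ_τ` at the third point `s/3`** (rational numbers):
`thirdVec r = ∑_{i ∈ B : res3 κᵢ s = r} pᵢ·(Hasse_{t₀} Rᵢ)(s/3)·∏ zγⱼ(i)^{tⱼ}·qPart3 κᵢ s`, `κᵢ = (uᵢ, u_θᵢ)`.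
[cite: Yu1989, §3] -/
def thirdVec (B : Finset ι) (p : ι → ℤ) (τ : Tau S.d) (s : ℤ) (r : Fin (S.d + 1) → Fin 3) : ℚ :=
  ∑ i ∈ B with S.res3 (Fin.snoc (u i) (uθ i)) s = r,
    (p i : ℚ) * ((hasseDeriv τ.1 (R i)).eval ((s : ℚ) / 3) * S.zγpow u uθ i τ.2 *
      S.qPart3 (Fin.snoc (u i) (uθ i)) s)

/-- The `Y₀`-weight at the third point, read in `ℚ₂`. [folklore] -/
theorem hw_eval_third (i : ι) (t₀ : ℕ) (s : ℤ) :
    (hw R i t₀).eval ((s : ℚ_[2]) * ((3 : ℕ) : ℚ_[2])⁻¹) =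
      (((hasseDeriv t₀ (R i)).eval ((s : ℚ) / 3) : ℚ) : ℚ_[2]) := by
  unfold hw
  have e : ((s : ℚ_[2]) * ((3 : ℕ) : ℚ_[2])⁻¹) = algebraMap ℚ ℚ_[2] ((s : ℚ) / 3) := by
    rw [eq_ratCast (algebraMap ℚ ℚ_[2]) ((s : ℚ) / 3)]; push_cast; ring
  rw [e, Polynomial.eval_map, Polynomial.eval₂_at_apply, eq_ratCast]

/-- **`φ_τ(s/3) = ev3 cbrt (thirdVec B p τ s)`**: the value at a third point is the evaluation at the principal
cube roots of the triadic class sums. [cite: Yu1990, §3 (2.93)–(2.95)] -/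
theorem g3Φ_third_eq_ev3 (B : Finset ι) (p : ι → ℤ) (τ : Tau S.d) (s : ℤ) :
    S.g3Φ R u uθ B p τ ((s : ℚ_[2]) * ((3 : ℕ) : ℚ_[2])⁻¹) = Multicub.ev3 S.cbrt (S.thirdVec R u uθ B p τ s) := by
  classical
  rw [S.g3Φ_third]
  unfold Multicub.ev3 thirdVec
  have hfib : ∑ i ∈ B, (p i : ℚ_[2]) * ((hw R i τ.1).eval ((s : ℚ_[2]) * ((3 : ℕ) : ℚ_[2])⁻¹) *
      (S.zγpow u uθ i τ.2 : ℚ_[2]) *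
      ∏ k : Fin (S.d + 1), S.cbrt k ^ ((Fin.snoc (u i) (uθ i) : Fin (S.d + 1) → ℤ) k * s)) =
      ∑ i ∈ B, (((p i : ℚ) * ((hasseDeriv τ.1 (R i)).eval ((s : ℚ) / 3) * S.zγpow u uθ i τ.2 *
        S.qPart3 (Fin.snoc (u i) (uθ i)) s) : ℚ) : ℚ_[2]) *
        Multicub.mono3 S.cbrt (S.res3 (Fin.snoc (u i) (uθ i)) s) := by
    refine sum_congr rfl fun i _ => ?_
    rw [S.prod_cbrt_zpow_eq, hw_eval_third R]
    push_cast
    ring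
  rw [hfib, ← Finset.sum_fiberwise B (fun i => S.res3 (Fin.snoc (u i) (uθ i)) s)
    (fun i => (((p i : ℚ) * ((hasseDeriv τ.1 (R i)).eval ((s : ℚ) / 3) * S.zγpow u uθ i τ.2 *
        S.qPart3 (Fin.snoc (u i) (uθ i)) s) : ℚ) : ℚ_[2]) *
        Multicub.mono3 S.cbrt (S.res3 (Fin.snoc (u i) (uθ i)) s))]
  refine sum_congr rfl fun r _ => ?_
  rw [Rat.cast_sum, sum_mul]
  refine sum_congr rfl fun i hi => ?_
  rw [(Finset.mem_filter.mp hi).2]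

/-- **Separation at a third point (statement shape for the Liouville step)**: if `thirdVec B p τ s ≠ 0` then
`ev3 cbrt (thirdVec) ≠ 0` is NOT automatic — it is the multicubic Liouville inequality
(`MulticubLiouville.norm_ev3_ge_padic_rat`, with the `3`-Kummer condition) that bounds `‖ev3‖` from below; this
lemma records only the trivial direction `thirdVec = 0 ⇒ φ_τ(s/3) = 0`. [folklore] -/
theorem g3Φ_third_eq_zero_of_thirdVec_eq_zero (B : Finset ι) (p : ι → ℤ) (τ : Tau S.d) (s : ℤ)
    (h : S.thirdVec R u uθ B p τ s = 0) :
    S.g3Φ R u uθ B p τ ((s : ℚ_[2]) * ((3 : ℕ) : ℚ_[2])⁻¹) = 0 := by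
  rw [S.g3Φ_third_eq_ev3, h, Multicub.ev3_zero]

end TwoSetup

end Summit.ABC.StewartYu

end
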